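import Mathlib
import Summits.ResolutionOfSingularities.ResolutionOfSingularities.Theorems.WeightedInvariantLocalWeightedDropNCResSettingNear
import Summits.ResolutionOfSingularities.ResolutionOfSingularities.Theorems.WeightedInvariantLocalWeightedDropNCResSettingAdmissible
import Summits.ResolutionOfSingularities.ResolutionOfSingularities.Theorems.WeightedInvariantLocalWeightedDropTOT2NearDir
import Summits.ResolutionOfSingularities.ResolutionOfSingularities.Theorems.WeightedInvariantLocalWeightedDropTOT2NearCurve

/-!
# `WeightedInvariant.LocalWeightedDrop`, TOT₂ line (skeleton v32, residual `stub_spaceNCRankDrop`), piece S-NEAR part 6: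
# THE NEAR-POINT THEOREMS ON DECORATED STATES (S-SET vocabulary: `Decoration`, `IsBPermissible`, `transform`)

Crux item stmt-ResolutionOfSingularities-8899 `LocalWeightedDrop`; sub-line TOT2-LINE v1/v1.1 (`L/res-L1-w43-lead-1/g4/TOT2-LINE.md`) §4.
[OURS · L1 W4.3, chain w43, res-L1-w43-stub-3 (gen 4) = S-NEAR hand; glue of parts 1–3 (`…TOT2Near`, `…TOT2NearDir`, `…TOT2NearCurve`) to
res-L1-w43-stub-1's S-SET files (`…NCResSettingDefs` p528587, `…NCResSettingStrict`, `…NCResSettingNear`, `…NCResSettingAdmissible`), whose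
`Decoration.nearData_of_o_transform_eq` delivers exactly the hypothesis package `(hfac, s ∤ G, hnear)` of parts 1–3 for the equation in the move's
coordinates `F := f∘Φ` at degree `δ.o`.  AI-written; gate-accepted means sorry-free with standard axioms, not refereed.  Def-free.]

For a decoration `δ` with `δ.f ≠ 0`, a B-permissible move `(Φ, w)` (`IsBPermissible δ Φ w`), an answer `(c, i)` (chart convention
`w_l = 0 → c_l = 0`, live slot `c_i ≠ 0`); `F := subst Φ δ.f` (the equation in the move's coordinates), `in F := v ↦ initEval 1 v δ.o F`,
invariance vectors written out as in parts 1–5; NEAR = «the order did not drop»: `(δ.transform Φ w c i).o = δ.o`.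
* `Decoration.weightedOrder_ge`, `Decoration.order_substF` — (P1) and the order, in the shape parts 3–5 want.
* **`Decoration.tangent_inv`** — `T_x C ⊆ Dir(in F)`: vectors supported on the weight-`0` letters are invariance vectors (no nearness).
* **`Decoration.inv_of_near`** — (N1)/(N3): at a near answer, `c` (and every `t • c`) is an invariance vector of `in F`.
* **`Decoration.o_transform_lt_of_apexLine`** — `e ≤ 1` (binder `hone` for `F`) and a centre of positive dimension (`w_l = 0` for some `l`):
  the order DROPS at every answer.
* **`Decoration.apexLine_transform`** — (N2): `hone` for `F` at `δ.o` and a near answer ⇒ `hone` for the transform's equation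
  `(δ.transform Φ w c i).f` at its order `(δ.transform Φ w c i).o` (for a point move by part 2; for a centre of positive dimension vacuously).
* **`Decoration.transform_inv_eq_zero_of_apply_zero`** — with `hone` for `F`, an `s`-free invariance vector of the transform's form is `0`
  (the new directrix line is transverse to the new exceptional letter `0`).
-/

set_option linter.dupNamespace false -- mandated namespace of this single-conjunct summit
set_option autoImplicit false

noncomputable section

namespace Summit.ResolutionOfSingularities.ResolutionOfSingularities.Theorems

namespace TOT2Near

open MvPowerSeries Literature.AlgebraicGeometry.Resolution TameFourTupleDrop

variable {k : Type} [Field k] {m : ℕ}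
variable {δ : Decoration k m} {Φ : Fin (m + 1) → MvPowerSeries (Fin (m + 1)) k} {w : Fin (m + 1) → ℕ} {c : Fin (m + 1) → k}
  {i : Fin (m + 1)}

/-! ## §1 The equation in the move's coordinates: order and permissibility in the shape of parts 3–5 -/

/-- The order of `F = f∘Φ` is `δ.o` (a legal coordinate change preserves the order). -/
theorem Decoration.order_substF (hmv : IsCountMove Φ w) (hf : δ.f ≠ 0) : (subst Φ δ.f).order = δ.o := by
  have hfin : δ.f.order ≠ ⊤ := by rw [ne_eq, order_eq_top_iff]; exact hf
  rw [NCTransport.order_subst_eq_of_isUnit_det hmv.1 hmv.2.1 δ.f, Decoration.o, ENat.coe_toNat hfin]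

/-- (P1) in the shape of part 3: `δ.o ≤ weightedOrder_w (f∘Φ)`. -/
theorem Decoration.weightedOrder_ge (hperm : IsBPermissible δ Φ w) (hf : δ.f ≠ 0) :
    ((δ.o : ℕ) : ℕ∞) ≤ (subst Φ δ.f).weightedOrder w := by
  rw [← Decoration.order_substF hperm.1 hf]
  exact hperm.2.1

/-! ## §2 `T_x C ⊆ Dir` and (N1)/(N3) on decorated states -/

/-- **`T_x C ⊆ Dir(in F)`**: under a B-permissible move, every vector supported on the weight-`0` letters (a tangent vector of the centre
`C = V(x_l : w_l = 1)`) is an invariance vector of the degree-`o` form of `F = f∘Φ`. -/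
theorem Decoration.tangent_inv (hperm : IsBPermissible δ Φ w) (hf : δ.f ≠ 0) {u : Fin (m + 1) → k}
    (hu : ∀ l, w l ≠ 0 → u l = 0) (v : Fin (m + 1) → k) :
    CobordantChart.initEval (fun _ : Fin (m + 1) => 1) (v + u) δ.o (subst Φ δ.f) =
      CobordantChart.initEval (fun _ : Fin (m + 1) => 1) v δ.o (subst Φ δ.f) :=
  initEval_add_eq_of_perm hperm.1.2.2.1 (Decoration.weightedOrder_ge hperm hf) hu v

/-- **(N1)/(N3) ON DECORATED STATES — A NEAR ANSWER LIES ON `ℙ(Dir / T_x C)`**: if the order did not drop at the answer `(c, i)` of a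
B-permissible move, then `c` spans a line of invariance vectors of the degree-`o` form of `F = f∘Φ`. -/
theorem Decoration.inv_of_near (hperm : IsBPermissible δ Φ w) (hc0 : ∀ l, w l = 0 → c l = 0) (hf : δ.f ≠ 0) (hci : c i ≠ 0)
    (heq : (δ.transform Φ w c i).o = δ.o) (t : k) (v : Fin (m + 1) → k) :
    CobordantChart.initEval (fun _ : Fin (m + 1) => 1) (v + t • c) δ.o (subst Φ δ.f) =
      CobordantChart.initEval (fun _ : Fin (m + 1) => 1) v δ.o (subst Φ δ.f) := by
  obtain ⟨hfac, -, hnear⟩ := Decoration.nearData_of_o_transform_eq hperm hc0 hf hci heq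
  exact initEval_add_smul_eq_of_near_curve w c hperm.1.2.2.1 hc0 i hci (subst Φ δ.f) (Decoration.weightedOrder_ge hperm hf) hfac
    hnear t v

/-! ## §3 `e ≤ 1`: centres of positive dimension drop the order; (N2) for the transform -/

/-- **`e ≤ 1` AND A CENTRE OF POSITIVE DIMENSION ⇒ THE ORDER DROPS AT EVERY ANSWER**: if every two invariance vectors of the degree-`o` form of
`F = f∘Φ` are dependent and the centre has a tangent letter (`w_l = 0`), then `o' < o` at every answer of the move. -/
theorem Decoration.o_transform_lt_of_apexLine (hperm : IsBPermissible δ Φ w) (hc0 : ∀ l, w l = 0 → c l = 0) (hf : δ.f ≠ 0)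
    (hci : c i ≠ 0)
    (hone : ∀ u₁ u₂ : Fin (m + 1) → k,
      (∀ v, CobordantChart.initEval (fun _ : Fin (m + 1) => 1) (v + u₁) δ.o (subst Φ δ.f) =
        CobordantChart.initEval (fun _ : Fin (m + 1) => 1) v δ.o (subst Φ δ.f)) →
      (∀ v, CobordantChart.initEval (fun _ : Fin (m + 1) => 1) (v + u₂) δ.o (subst Φ δ.f) =
        CobordantChart.initEval (fun _ : Fin (m + 1) => 1) v δ.o (subst Φ δ.f)) →
      ∃ α β : k, (α ≠ 0 ∨ β ≠ 0) ∧ α • u₁ + β • u₂ = 0)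
    {l : Fin (m + 1)} (hl : w l = 0) : (δ.transform Φ w c i).o < δ.o := by
  refine lt_of_le_of_ne (Decoration.o_transform_le hperm hc0 hf hci) fun heq => ?_
  obtain ⟨hfac, -, hnear⟩ := Decoration.nearData_of_o_transform_eq hperm hc0 hf hci heq
  exact absurd hnear (not_le.mpr (order_slice_lt_of_apexLine_curve w c hperm.1.2.2.1 hc0 i hci (subst Φ δ.f)
    (Decoration.weightedOrder_ge hperm hf) hone hl hfac))

/-- **(N2) ON DECORATED STATES — `e ≤ 1` PERSISTS AT NEAR ANSWERS**: if every two invariance vectors of the degree-`o` form of `F = f∘Φ` are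
dependent and the order did not drop at the answer `(c, i)`, then every two invariance vectors of the degree-`o'` form of the transform's
equation are dependent (`o' = o`; the move is necessarily the point move, by `Decoration.o_transform_lt_of_apexLine`). -/
theorem Decoration.apexLine_transform (hperm : IsBPermissible δ Φ w) (hc0 : ∀ l, w l = 0 → c l = 0) (hf : δ.f ≠ 0) (hci : c i ≠ 0)
    (hone : ∀ u₁ u₂ : Fin (m + 1) → k,
      (∀ v, CobordantChart.initEval (fun _ : Fin (m + 1) => 1) (v + u₁) δ.o (subst Φ δ.f) =
        CobordantChart.initEval (fun _ : Fin (m + 1) => 1) v δ.o (subst Φ δ.f)) →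
      (∀ v, CobordantChart.initEval (fun _ : Fin (m + 1) => 1) (v + u₂) δ.o (subst Φ δ.f) =
        CobordantChart.initEval (fun _ : Fin (m + 1) => 1) v δ.o (subst Φ δ.f)) →
      ∃ α β : k, (α ≠ 0 ∨ β ≠ 0) ∧ α • u₁ + β • u₂ = 0)
    (heq : (δ.transform Φ w c i).o = δ.o) (w₁ w₂ : Fin (m + 1) → k)
    (hw₁ : ∀ v, CobordantChart.initEval (fun _ : Fin (m + 1) => 1) (v + w₁) (δ.transform Φ w c i).o (δ.transform Φ w c i).f =
      CobordantChart.initEval (fun _ : Fin (m + 1) => 1) v (δ.transform Φ w c i).o (δ.transform Φ w c i).f)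
    (hw₂ : ∀ v, CobordantChart.initEval (fun _ : Fin (m + 1) => 1) (v + w₂) (δ.transform Φ w c i).o (δ.transform Φ w c i).f =
      CobordantChart.initEval (fun _ : Fin (m + 1) => 1) v (δ.transform Φ w c i).o (δ.transform Φ w c i).f) :
    ∃ α β : k, (α ≠ 0 ∨ β ≠ 0) ∧ α • w₁ + β • w₂ = 0 := by
  -- the centre is the point: all weights are `1`
  have hw1 : w = fun _ => 1 := by
    funext l
    refine le_antisymm (hperm.1.2.2.1 l) (Nat.one_le_iff_ne_zero.mpr fun hl => ?_)
    exact absurd heq (ne_of_lt (Decoration.o_transform_lt_of_apexLine hperm hc0 hf hci hone hl))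
  obtain ⟨hfac, -, hnear⟩ := Decoration.nearData_of_o_transform_eq hperm hc0 hf hci heq
  rw [heq, Decoration.transform_f_eq_strict_of_o_transform_eq hperm hc0 hf hci heq] at hw₁ hw₂
  subst hw1
  exact apexLine_of_near (subst Φ δ.f) c i hci hfac hnear hone w₁ w₂ hw₁ hw₂

/-- **… AND THE NEW DIRECTRIX LINE IS TRANSVERSE TO THE NEW EXCEPTIONAL LETTER**: with `hone` for `F`, at a near answer an invariance vector of
the transform's form with vanishing `s`-component (letter `0`) is `0`. -/
theorem Decoration.transform_inv_eq_zero_of_apply_zero (hperm : IsBPermissible δ Φ w) (hc0 : ∀ l, w l = 0 → c l = 0) (hf : δ.f ≠ 0)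
    (hci : c i ≠ 0)
    (hone : ∀ u₁ u₂ : Fin (m + 1) → k,
      (∀ v, CobordantChart.initEval (fun _ : Fin (m + 1) => 1) (v + u₁) δ.o (subst Φ δ.f) =
        CobordantChart.initEval (fun _ : Fin (m + 1) => 1) v δ.o (subst Φ δ.f)) →
      (∀ v, CobordantChart.initEval (fun _ : Fin (m + 1) => 1) (v + u₂) δ.o (subst Φ δ.f) =
        CobordantChart.initEval (fun _ : Fin (m + 1) => 1) v δ.o (subst Φ δ.f)) →
      ∃ α β : k, (α ≠ 0 ∨ β ≠ 0) ∧ α • u₁ + β • u₂ = 0)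
    (heq : (δ.transform Φ w c i).o = δ.o) {w₁ : Fin (m + 1) → k}
    (hw₁ : ∀ v, CobordantChart.initEval (fun _ : Fin (m + 1) => 1) (v + w₁) (δ.transform Φ w c i).o (δ.transform Φ w c i).f =
      CobordantChart.initEval (fun _ : Fin (m + 1) => 1) v (δ.transform Φ w c i).o (δ.transform Φ w c i).f)
    (h0 : w₁ 0 = 0) : w₁ = 0 := by
  have hw1 : w = fun _ => 1 := by
    funext l
    refine le_antisymm (hperm.1.2.2.1 l) (Nat.one_le_iff_ne_zero.mpr fun hl => ?_)
    exact absurd heq (ne_of_lt (Decoration.o_transform_lt_of_apexLine hperm hc0 hf hci hone hl))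
  obtain ⟨hfac, -, hnear⟩ := Decoration.nearData_of_o_transform_eq hperm hc0 hf hci heq
  rw [heq, Decoration.transform_f_eq_strict_of_o_transform_eq hperm hc0 hf hci heq] at hw₁
  subst hw1
  exact inv_eq_zero_of_near_of_apply_zero (subst Φ δ.f) c i hci hfac hnear hone hw₁ h0

end TOT2Near

end Summit.ResolutionOfSingularities.ResolutionOfSingularities.Theorems

end
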